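import Literature.NumberTheory.LFunctions.ZetaSqReflectionPrinciple
import Literature.NumberTheory.LFunctions.EulerMaclaurinZeta
import Literature.NumberTheory.LFunctions.RademacherDirichletLConvexity
import Literature.Analysis.SpecialFunctions.GammaProductBounds
import HarnessLib

/-!
# The critical-line remainder of the smoothed logarithmic second moment of `ν ∗ ν`, from the
# log-free convexity bound

Topic `Literature/NumberTheory/LFunctions`. Everything here is PROVED (no definitions, no named facts).

For a primitive Dirichlet character `χ` mod `q > 1` and `0 < A ≤ B` consider the remainder of the
explicit formula for `W_{ν∗ν}(B) − W_{ν∗ν}(A)` (`ν = 1 ∗ χ`) on the line `re z = −1/2`: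

  `E = (1/2π) ∫ ζ(1+z)² Γ(z) (B^z − A^z) (L(1+z,χ)² − L(1,χ)²) dy`,  `z = −1/2 + iy`.

Assuming the log-free convexity bound `|L(½+it,χ)| ≤ C q^{1/4}(1+|t|)` (the tree's target
`stub_logfree_convexity`, taken here as a HYPOTHESIS), we prove `‖E‖ ≤ C′ √q A^{-1/2}` with an
absolute `C′` (`critical_line_integral_le_of_logFreeConvexity`): pointwise
`|ζ(½+iy)| ≤ 3(1+|y|)³` (Euler–Maclaurin, `norm_riemannZeta_le_of_neg_one_le_re`),
`|Γ(−½+iy)| ≤ 2√(2π) e^{-π|y|/2}` (`norm_Gamma_half_le` and `Γ(z+1) = zΓ(z)`),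
`|B^z − A^z| ≤ 2A^{-1/2}`, `|L(1,χ)|² ≤ √q ζ(3/2)²` (Rademacher's Theorem 3 at `s = 1`, `η = ½`),
and `∫ (1+|y|)⁸ e^{-π|y|/2} dy < ∞`. This is stub T4 of SKELETON I6c-typed (line
`majorant-critical-line`, cell landau-siegel/ls-inputs), i.e. Conrey–Iwaniec's
"`(1/2πi)∫_{(−1/2)} ǧ(s) R_K(s+1) ds = O((q/X)^{1/2})`" for the majorant `ν ∗ ν` and the Mellin
kernel `Γ(z)(B^z − A^z)`, conditionally on the convexity input.

## References
* [ConreyIwaniec2002] B. Conrey, H. Iwaniec, Acta Arith. 103 (2002) 259–312, §6 (6.47)–(6.48).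
-/

noncomputable section

open Complex MeasureTheory Real Set Filter

namespace Literature.NumberTheory.LFunctions.DivisorSumCharSq

open Literature.NumberTheory.LFunctions.ZetaM4 (integrable_pow_mul_exp)
open Literature.Analysis.SpecialFunctions (norm_Gamma_half_le)

/-! ### Pointwise bounds on the line `re z = −1/2` -/

/-- `|ζ(½ + iy)| ≤ 3 (1+|y|)³` (Euler–Maclaurin). [cite: ConreyIwaniec2002, §6 (6.48)] -/
private theorem norm_zeta_half_le (y : ℝ) :
    ‖riemannZeta (1 / 2 + y * I)‖ ≤ 3 * (1 + |y|) ^ 3 := by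
  set s : ℂ := 1 / 2 + y * I with hs
  have hre : s.re = 1 / 2 := by simp [hs]
  have him : s.im = y := by simp [hs]
  have hs1 : s ≠ 1 := by intro h; have := congrArg Complex.re h; rw [hre] at this; norm_num at this
  have h := Literature.NumberTheory.LFunctions.norm_riemannZeta_le_of_neg_one_le_re
    (s := s) (by rw [hre]; norm_num) hs1
  have hy0 : 0 ≤ |y| := abs_nonneg y
  set p : ℝ := 1 + |y| with hp
  have hp1 : 1 ≤ p := by rw [hp]; linarith
  have hns : ‖s‖ ≤ p := by
    have := Complex.norm_le_abs_re_add_abs_im s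
    rw [hre, him] at this
    rw [hp]; have : |(1:ℝ)/2| = 1/2 := by norm_num
    linarith [abs_nonneg y, Complex.norm_le_abs_re_add_abs_im s]
  have hs1n : 1 / 2 ≤ ‖s - 1‖ := by
    have := Complex.abs_re_le_norm (s - 1)
    rw [sub_re, hre, one_re] at this
    norm_num at this
    linarith
  have hinv : 1 / ‖s - 1‖ ≤ 2 := by
    rw [div_le_iff₀ (by linarith)]; linarith
  have h1 : ‖s + 1‖ ≤ 2 * p := by
    have := norm_add_le s 1; rw [norm_one] at this; linarith
  have h2 : ‖s + 2‖ ≤ 3 * p := by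
    have := norm_add_le s 2
    rw [show ‖(2 : ℂ)‖ = 2 by norm_num] at this; linarith
  have hn0 : 0 ≤ ‖s‖ := norm_nonneg _
  calc ‖riemannZeta s‖ ≤ 1 / ‖s - 1‖ + 1 / 2 + ‖s‖ / 12 + ‖s‖ * ‖s + 1‖ * ‖s + 2‖ / 48 := h
    _ ≤ 2 + 1 / 2 + p / 12 + p * (2 * p) * (3 * p) / 48 := by
        gcongr
    _ ≤ 3 * p ^ 3 := by nlinarith [one_le_pow₀ (n := 2) hp1, one_le_pow₀ (n := 3) hp1]

/-- `|Γ(−½ + iy)| ≤ 2√(2π) e^{-π|y|/2}` (from `Γ(½+iy) = (−½+iy)Γ(−½+iy)` and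
`|Γ(½+iy)|² = π/cosh(πy)`). [cite: ConreyIwaniec2002, §6 (6.48)] -/
private theorem norm_Gamma_neg_half_le (y : ℝ) :
    ‖Complex.Gamma (((-(1 / 2 : ℝ)) : ℂ) + y * I)‖ ≤
      2 * Real.sqrt (2 * π) * Real.exp (-(π * |y|) / 2) := by
  set z : ℂ := ((-(1 / 2 : ℝ)) : ℂ) + y * I with hz
  have hz0 : z ≠ 0 := by
    intro h; have := congrArg Complex.re h; simp [hz] at this
  have hrec : Complex.Gamma (z + 1) = z * Complex.Gamma z := Complex.Gamma_add_one z hz0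
  have hz1 : z + 1 = 1 / 2 + y * I := by rw [hz]; push_cast; ring
  have hhalf := norm_Gamma_half_le y
  rw [← hz1, hrec, norm_mul] at hhalf
  have hzn : 1 / 2 ≤ ‖z‖ := by
    have := Complex.abs_re_le_norm z
    have hre : z.re = -(1 / 2) := by simp [hz]
    rw [hre] at this; norm_num at this; exact this
  have hE : 0 ≤ Real.sqrt (2 * π) * Real.exp (-(π * |y|) / 2) := by positivity
  have hG : 0 ≤ ‖Complex.Gamma z‖ := norm_nonneg _
  nlinarith

/-- `|L(1,χ)|² ≤ √q · ζ(3/2)²` for `χ` primitive mod `q > 1` (Rademacher's Theorem 3 at `s = 1`,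
`η = ½`: `|L(1,χ)| ≤ (q/π)^{1/4} ζ(3/2)`). [cite: Rademacher1959, §6 Theorem 3, p. 199] -/
private theorem norm_LFunction_one_sq_le {q : ℕ} [NeZero q] (hq : 1 < q) {χ : DirichletCharacter ℂ q}
    (hχ : χ.IsPrimitive) :
    ‖χ.LFunction 1‖ ^ 2 ≤ Real.sqrt q * (riemannZeta (1 + (1 / 2 : ℝ))).re ^ 2 := by
  have h := Rademacher1959.norm_LFunction_le hq hχ (η := 1 / 2) (by norm_num) le_rfl (s := 1)
    (by norm_num) (by norm_num)
  have hZ : 0 < (riemannZeta (1 + (1 / 2 : ℝ))).re := by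
    have h' := Booker2006Turing.bigZ_pos (σ := 1 + 1 / 2) (by norm_num)
    rw [Booker2006Turing.bigZ] at h'
    simpa using h'
  have hqR : (0 : ℝ) < q := by exact_mod_cast (show 0 < q by omega)
  have hbase : (q : ℝ) * ‖(1 : ℂ) + 1‖ / (2 * π) = q / π := by
    rw [show (1 : ℂ) + 1 = 2 by norm_num, show ‖(2 : ℂ)‖ = 2 by norm_num]; field_simp
  have hexp : ((1 + 1 / 2 - (1 : ℂ).re) / 2 : ℝ) = 1 / 4 := by simp; norm_num
  rw [hbase, hexp] at h
  have hqπ : (q : ℝ) / π ≤ q := div_le_self hqR.le (by have := Real.pi_gt_three; linarith)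
  have h14 : ((q : ℝ) / π) ^ (1 / 4 : ℝ) ≤ (q : ℝ) ^ (1 / 4 : ℝ) :=
    Real.rpow_le_rpow (by positivity) hqπ (by norm_num)
  have hL0 : 0 ≤ ‖χ.LFunction 1‖ := norm_nonneg _
  have hL : ‖χ.LFunction 1‖ ≤ (q : ℝ) ^ (1 / 4 : ℝ) * (riemannZeta (1 + (1 / 2 : ℝ))).re :=
    h.trans (mul_le_mul_of_nonneg_right h14 hZ.le)
  have hsq : ((q : ℝ) ^ (1 / 4 : ℝ)) ^ 2 = Real.sqrt q := by
    rw [← Real.rpow_natCast, ← Real.rpow_mul hqR.le, Real.sqrt_eq_rpow]; norm_num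
  calc ‖χ.LFunction 1‖ ^ 2 ≤ ((q : ℝ) ^ (1 / 4 : ℝ) * (riemannZeta (1 + (1 / 2 : ℝ))).re) ^ 2 :=
        pow_le_pow_left₀ hL0 hL 2
    _ = Real.sqrt q * (riemannZeta (1 + (1 / 2 : ℝ))).re ^ 2 := by rw [mul_pow, hsq]

/-! ### The remainder bound -/

/-- **THE CRITICAL-LINE INTEGRAL** (stub T4 of SKELETON I6c-typed). If
`|L(½+it,χ)| ≤ C q^{1/4}(1+|t|)` for all primitive `χ` mod `q > 1` and all real `t`, then for
`χ` primitive mod `q > 1` and `0 < A ≤ B`,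
`‖(1/2π) ∫ ζ(1+z)² Γ(z)(B^z − A^z)(L(1+z,χ)² − L(1,χ)²) dy‖ ≤ C′ √q A^{-1/2}` (`z = −½ + iy`),
with an absolute `C′` — Conrey–Iwaniec's `O((q/X)^{1/2})` for the remainder of (6.48), here for the
majorant `ν ∗ ν` and the kernel `Γ(z)(B^z − A^z)`. [cite: ConreyIwaniec2002, §6 (6.48)] -/
theorem critical_line_integral_le_of_logFreeConvexity
    (hLFC : ∃ C : ℝ, 0 < C ∧ ∀ (q : ℕ) [NeZero q], 1 < q → ∀ χ : DirichletCharacter ℂ q,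
      χ.IsPrimitive → ∀ t : ℝ,
        ‖χ.LFunction (1 / 2 + t * I)‖ ≤ C * (q : ℝ) ^ (1 / 4 : ℝ) * (1 + |t|)) :
    ∃ C : ℝ, 0 < C ∧ ∀ (q : ℕ) [NeZero q], 1 < q → ∀ χ : DirichletCharacter ℂ q,
      χ.IsPrimitive → ∀ A B : ℝ, 0 < A → A ≤ B →
        ‖(1 / (2 * (Real.pi : ℂ))) * ∫ y : ℝ,
          riemannZeta (1 + ((-(1 / 2 : ℝ) : ℂ) + y * I)) ^ 2 *
            Complex.Gamma ((-(1 / 2 : ℝ) : ℂ) + y * I) *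
            ((B : ℂ) ^ ((-(1 / 2 : ℝ) : ℂ) + y * I) - (A : ℂ) ^ ((-(1 / 2 : ℝ) : ℂ) + y * I)) *
            (χ.LFunction (1 + ((-(1 / 2 : ℝ) : ℂ) + y * I)) ^ 2 - χ.LFunction 1 ^ 2)‖ ≤
          C * Real.sqrt q * A ^ (-(1 / 2 : ℝ)) := by
  obtain ⟨C, hC, hL⟩ := hLFC
  set Z : ℝ := (riemannZeta (1 + (1 / 2 : ℝ))).re with hZ
  set J : ℝ := ∫ y : ℝ, (1 + |y|) ^ 8 * Real.exp (-(π * |y| / 2)) with hJ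
  have hJ0 : 0 ≤ J := integral_nonneg fun y => by positivity
  set K : ℝ := 36 * Real.sqrt (2 * π) * (C ^ 2 + Z ^ 2) with hK
  have hK0 : 0 ≤ K := by positivity
  refine ⟨K * J / (2 * π) + 1, by positivity, fun q _ hq χ hχ A B hA hAB => ?_⟩
  have hqR : (0 : ℝ) < q := by exact_mod_cast (show 0 < q by omega)
  have hB : 0 < B := hA.trans_le hAB
  have hsq0 : 0 ≤ Real.sqrt q := Real.sqrt_nonneg _
  have hArp : 0 < A ^ (-(1 / 2 : ℝ)) := Real.rpow_pos_of_pos hA _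
  have hL1 := norm_LFunction_one_sq_le hq hχ
  rw [← hZ] at hL1
  -- the integrand and its majorant
  set F : ℝ → ℂ := fun y =>
    riemannZeta (1 + ((-(1 / 2 : ℝ) : ℂ) + y * I)) ^ 2 *
      Complex.Gamma ((-(1 / 2 : ℝ) : ℂ) + y * I) *
      ((B : ℂ) ^ ((-(1 / 2 : ℝ) : ℂ) + y * I) - (A : ℂ) ^ ((-(1 / 2 : ℝ) : ℂ) + y * I)) *
      (χ.LFunction (1 + ((-(1 / 2 : ℝ) : ℂ) + y * I)) ^ 2 - χ.LFunction 1 ^ 2) with hF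
  set g : ℝ → ℝ := fun y => K * Real.sqrt q * A ^ (-(1 / 2 : ℝ)) *
    ((1 + |y|) ^ 8 * Real.exp (-(π * |y| / 2))) with hg
  have hgi : Integrable g := (integrable_pow_mul_exp 8).const_mul _
  have hpt : ∀ y : ℝ, ‖F y‖ ≤ g y := by
    intro y
    have hy0 : 0 ≤ |y| := abs_nonneg y
    set p : ℝ := 1 + |y| with hp
    have hp1 : 1 ≤ p := by rw [hp]; linarith
    set z : ℂ := ((-(1 / 2 : ℝ)) : ℂ) + y * I with hz
    have hzre : z.re = -(1 / 2) := by simp [hz]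
    have h1z : (1 : ℂ) + z = 1 / 2 + y * I := by rw [hz]; push_cast; ring
    -- ζ
    have hζ : ‖riemannZeta (1 + z)‖ ≤ 3 * p ^ 3 := by rw [h1z]; exact norm_zeta_half_le y
    -- Γ
    have hΓ := norm_Gamma_neg_half_le y
    rw [← hz] at hΓ
    -- powers
    have hpowB : ‖(B : ℂ) ^ z‖ = B ^ (-(1 / 2 : ℝ)) := by
      rw [Complex.norm_cpow_eq_rpow_re_of_pos hB, hzre]
    have hpowA : ‖(A : ℂ) ^ z‖ = A ^ (-(1 / 2 : ℝ)) := by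
      rw [Complex.norm_cpow_eq_rpow_re_of_pos hA, hzre]
    have hBA : B ^ (-(1 / 2 : ℝ)) ≤ A ^ (-(1 / 2 : ℝ)) :=
      Real.rpow_le_rpow_of_nonpos hA hAB (by norm_num)
    have hpow : ‖(B : ℂ) ^ z - (A : ℂ) ^ z‖ ≤ 2 * A ^ (-(1 / 2 : ℝ)) := by
      refine (norm_sub_le _ _).trans ?_
      rw [hpowB, hpowA]; linarith
    -- L
    have hLz : ‖χ.LFunction (1 + z)‖ ≤ C * (q : ℝ) ^ (1 / 4 : ℝ) * p := by
      rw [h1z]; exact hL q hq χ hχ y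
    have hq4 : ((q : ℝ) ^ (1 / 4 : ℝ)) ^ 2 = Real.sqrt q := by
      rw [← Real.rpow_natCast, ← Real.rpow_mul hqR.le, Real.sqrt_eq_rpow]; norm_num
    have hLsq : ‖χ.LFunction (1 + z) ^ 2 - χ.LFunction 1 ^ 2‖ ≤
        (C ^ 2 + Z ^ 2) * Real.sqrt q * p ^ 2 := by
      refine (norm_sub_le _ _).trans ?_
      rw [norm_pow, norm_pow]
      have h1 : ‖χ.LFunction (1 + z)‖ ^ 2 ≤ (C * (q : ℝ) ^ (1 / 4 : ℝ) * p) ^ 2 :=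
        pow_le_pow_left₀ (norm_nonneg _) hLz 2
      have h2 : (C * (q : ℝ) ^ (1 / 4 : ℝ) * p) ^ 2 = C ^ 2 * Real.sqrt q * p ^ 2 := by
        rw [mul_pow, mul_pow, hq4]
      have h3 : Real.sqrt q * Z ^ 2 ≤ Z ^ 2 * Real.sqrt q * p ^ 2 := by
        rw [mul_comm (Real.sqrt q)]
        have : Z ^ 2 * Real.sqrt q * 1 ≤ Z ^ 2 * Real.sqrt q * p ^ 2 := by
          gcongr; exact one_le_pow₀ hp1
        linarith
      calc ‖χ.LFunction (1 + z)‖ ^ 2 + ‖χ.LFunction 1‖ ^ 2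
          ≤ C ^ 2 * Real.sqrt q * p ^ 2 + Z ^ 2 * Real.sqrt q * p ^ 2 := by
            rw [← h2]; exact add_le_add h1 (hL1.trans h3)
        _ = (C ^ 2 + Z ^ 2) * Real.sqrt q * p ^ 2 := by ring
    -- assemble
    have hF' : F y = riemannZeta (1 + z) ^ 2 * Complex.Gamma z * ((B : ℂ) ^ z - (A : ℂ) ^ z) *
        (χ.LFunction (1 + z) ^ 2 - χ.LFunction 1 ^ 2) := by simp only [hF, hz]
    rw [hF', norm_mul, norm_mul, norm_mul, norm_pow]
    have hexp : Real.exp (-(π * |y|) / 2) = Real.exp (-(π * |y| / 2)) := by ring_nf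
    calc ‖riemannZeta (1 + z)‖ ^ 2 * ‖Complex.Gamma z‖ * ‖(B : ℂ) ^ z - (A : ℂ) ^ z‖ *
          ‖χ.LFunction (1 + z) ^ 2 - χ.LFunction 1 ^ 2‖
        ≤ (3 * p ^ 3) ^ 2 * (2 * Real.sqrt (2 * π) * Real.exp (-(π * |y|) / 2)) *
            (2 * A ^ (-(1 / 2 : ℝ))) * ((C ^ 2 + Z ^ 2) * Real.sqrt q * p ^ 2) := by
          gcongr
      _ = g y := by
          simp only [hg, hK, hp, hexp]; ring
  have hint : ‖∫ y : ℝ, F y‖ ≤ ∫ y : ℝ, g y :=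
    norm_integral_le_of_norm_le hgi (Eventually.of_forall hpt)
  have hgint : ∫ y : ℝ, g y = K * Real.sqrt q * A ^ (-(1 / 2 : ℝ)) * J := by
    simp only [hg]; rw [integral_const_mul]
  have hπ : ‖(1 / (2 * (Real.pi : ℂ)))‖ = 1 / (2 * π) := by
    rw [norm_div, norm_one, norm_mul, Complex.norm_real, Real.norm_eq_abs,
      abs_of_pos Real.pi_pos, show ‖(2 : ℂ)‖ = 2 by norm_num]
  change ‖(1 / (2 * (Real.pi : ℂ))) * ∫ y : ℝ, F y‖ ≤ _
  rw [norm_mul, hπ]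
  have hπ0 : 0 < 1 / (2 * π) := by positivity
  calc 1 / (2 * π) * ‖∫ y : ℝ, F y‖ ≤ 1 / (2 * π) * (K * Real.sqrt q * A ^ (-(1 / 2 : ℝ)) * J) := by
        rw [← hgint]; exact mul_le_mul_of_nonneg_left hint hπ0.le
    _ = (K * J / (2 * π)) * (Real.sqrt q * A ^ (-(1 / 2 : ℝ))) := by ring
    _ ≤ (K * J / (2 * π) + 1) * (Real.sqrt q * A ^ (-(1 / 2 : ℝ))) :=
        mul_le_mul_of_nonneg_right (by linarith) (by positivity)
    _ = (K * J / (2 * π) + 1) * Real.sqrt q * A ^ (-(1 / 2 : ℝ)) := by ring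

end Literature.NumberTheory.LFunctions.DivisorSumCharSq

end
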